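import Summits.BirchSwinnertonDyer.Rank1Residual.X2.NonsplitHalvesOnTree
import Summits.BirchSwinnertonDyer.Rank1Residual.X2.RankOneNonsplitTransfer
import Summits.BirchSwinnertonDyer.Rank1Residual.X2.IsogenyQuotientLine
import Summits.BirchSwinnertonDyer.Rank1Residual.X2.HeegnerTamagawaOdd
import Literature.NumberTheory.EllipticCurves.ZpExtensionAnticyclotomicHoldsProofs
import Literature.NumberTheory.EllipticCurves.KrizLi2019.SexticTwistBSDThreeDescent
import HarnessLib

/-!
# O9 ∩ {non-split} AT THE CLASS LEVEL: `X2c ∩ {non-split} ⇒ BSD(E,p)` from the three declared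
# residuals c1–c3 + Mazur's main conjecture on X2b ∩ {non-split} + PUBLISHED facts — every datum
# of the (b1) road PRODUCED (cell `bsd-eis`, seat `bsd-eis-cgshw` g4; route `EisensteinPrimes`,
# crux 4 `BSDpOnCellC`, line L4-b1, stub `stub_nonsplit`)

HONEST FRAMING (cell `bsd-eis`): theorems only; nothing booked; X2 stays CONSTRUCTION-SHAPED; no
label moves. The (b1) road of the non-split O9 display (`X2/NonsplitHalvesOnTree.lean`, p404431 /
p404695) concludes `BSDp W p` at a rank-one X2 pair AT A HEEGNER DATUM — a parametrisation datum
`Dt` with `p ∤ c`, an admissible `K`, the Heegner point `P ∈ E(K)` of infinite order, a globally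
minimal model of the twist with its two Tamagawa values, `ord_p ∏_w c_w(E/K) = 2·ord_p ∏_ℓ c_ℓ(E)`,
an anticyclotomic `ℤ_p`-extension with a topological generator and a degree-one prime `𝔭 ∋ p` —
from the three declared residuals c1 `HsiehFrameResidualAt W p`, c2 `NonsplitBDPValueOnTree W p`,
c3 `NonsplitIMCEqOnTree W p` (all `X2/NonsplitBDPExists.lean`, p404147) and a partner input. This
file PRODUCES every such datum from PUBLISHED named facts and tree theorems, so that the road reads
as the planner's stub of line L4-b1 (`plan-g13/k5b/LINES-PLAN-delta.md`):

  `stub_nonsplit : ∀ W p, X2.CellC W p → ¬ split(p) → BSDp W p`  ⇐  c1 ∧ c2 ∧ c3 (at every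
  non-split CellC pair) + `X2.MazurMainConjectureAt` on X2b ∩ {non-split} (crux 3's non-split half,
  needed only for the ψ-odd pairs) + PUBLISHED facts.

Contents (theorems only; the Tamagawa binder `htamK` — `ord_p ∏_w c_w(E/K) = 2·ord_p ∏_ℓ c_ℓ(E)`
at every odd `p` on a Heegner field — is the sibling `X2/HeegnerTamagawaOdd.lean`):
* `bsdp_of_cellC_of_not_split_of_manin_of_residuals` — at a non-split CellC pair carrying a Manin
  datum prime to `p` (`HasPrimeToManinDatum W p`): `BSDp W p` from c1, c2, c3 at the pair, Mazur's MC
  on X2b ∩ {non-split} at the same prime, and the published facts; the admissible `K` by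
  Hoffstein–Luo (`exists_admissibleField_of_rootNumber_eq_neg_one`), the Heegner datum and its
  `K`-rational point (Gross 1984 / Darmon 2004, `hHP`), non-torsion by Gross–Zagier
  (`lDerivEK_ne_zero_iff_not_isOfFinAddOrder` with `L'(E/K,1) = L'(E,1)·L(E^K,1) ≠ 0`), the twist's
  transport package (`twistTransportPackage_holds`), the anticyclotomic `ℤ_p`-extension
  (`ZpExtension.exists_isAnticyclotomic_holds`), the degree-one prime
  (`X11b.exists_degreeOnePrime_of_splitsIn`); the partner's rank-zero `p`-part by cases on its
  Greenberg–Vatsal parity (X2a closed: `targetA_of_published`; X2b ∩ {non-split}: the MC input through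
  `bsdp_of_mazurMainConjectureAt_of_analyticRank_eq_zero`; the twist stays non-split:
  `not_hasSplitMultiplicativeReductionAtPrime_of_smul_eq_quadraticTwist`).
* `bsdp_of_cellC_of_not_split_of_residuals` — **the class-level statement**: the Manin condition
  moved to the `X₀(N)`-optimal curve of the isogeny class (`exists_isIsogenous_hasPrimeToManinDatum`:
  Edixhoven, Mazur 1978 Cor. 4.1, modularity; CellC and non-splitness are isogeny invariants,
  `CellC.of_isIsogenous`, `IsogenyQuotientLine.hasSplitMultiplicativeReductionAtPrime_of_isIsogenous`;
  Cassels brings `BSD(E,p)` back, `bsdp_of_isIsogenous_of_bsdp`).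

So the NON-SPLIT half of crux 4 `BSDpOnCellC` (route `EisensteinPrimes`; O9 ∩ {non-split}:
2 552 + 2 830 @3, 93 + 178 @5, 17 + 7 @7 classes) reads, with NO per-pair binder: PUBLISHED facts +
c1 + c2 + c3 + [Mazur's MC on X2b ∩ {non-split}]. CONDITIONAL on every listed binder (c1–c3 are
`@[conjecture]` predicates NOT in print at a reducible `p ‖ N`; Keller–Yin Thm. D is a PREPRINT with
the L1754 gap; Hsieh 2014 Thm. 1 is PUB). Nothing booked; no label change.

References: [CastellaEtAl2021] Thm. 5.3.1 and (5.6); [JetchevSkinnerWan2017] §7.4.1 (eq:tamK);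
[Hsieh2014] Thm. 1; [Castella2018] Thm. 2.3, 3.2, §5; [KellerYin2024] Thm. D (PRE); [Mazur1978]
Cor. 4.1; [MilneADT2006] Thm. I.7.3 (Cassels); [GrossZagier1986] I.(6.3), V.§2; [Gross1991] (1.1);
[Darmon2004] Thm. 3.6; [SilvermanATAEC1994] IV.9 Table 4.1; [Miller2011LMS] Def. 1.1.
-/

set_option autoImplicit false

noncomputable section

open scoped Classical MatrixGroups ModularForm

open CongruenceSubgroup WeierstrassCurve NumberField IsDedekindDomain Field PowerSeries
  Literature.NumberTheory.EllipticCurves Literature.NumberTheory.EllipticCurves.GreenbergSelmer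
  Literature.NumberTheory.EllipticCurves.ModularForms Literature.NumberTheory.QuadraticFields
  Literature.NumberTheory.EllipticCurves.Rank1Residual
  Literature.NumberTheory.EllipticCurves.Rank1Residual.Typed
  Literature.NumberTheory.EllipticCurves.KrizLi2019
  Literature.NumberTheory.EllipticCurves.GreenbergVatsal2000
  Literature.NumberTheory.EllipticCurves.Wuthrich2014
  Literature.NumberTheory.EllipticCurves.SteinWuthrich2013
  Literature.NumberTheory.GaloisRepresentations Literature.NumberTheory.GaloisCohomology
  Literature.NumberTheory.Automorphic
  Summit.BirchSwinnertonDyer.Rank1Residual.X11b.AcSelmer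
  Summit.BirchSwinnertonDyer.Rank1Residual.X11b.Halves
  Summit.BirchSwinnertonDyer.Rank1Residual.X11b

namespace Summit.BirchSwinnertonDyer.Rank1Residual.X2

/-! ### Pointwise: a non-split CellC pair carrying a Manin datum prime to `p` -/

section Pointwise

variable (W : WeierstrassCurve ℚ) [W.IsElliptic] [W.IsGloballyMinimal] (p : ℕ) [Fact p.Prime]

/-- **X2c ∩ {non-split} ⇒ `BSD(E,p)` at a pair carrying a Manin datum prime to `p`, from the three
declared residuals at the pair, Mazur's MC on X2b ∩ {non-split}, and PUBLISHED facts — every datum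
of the (b1) road PRODUCED.** For a rank-one X2 pair `(E,p)` at a NON-split `p` with
`HasPrimeToManinDatum W p`: `w(E) = −1` (modularity); an admissible `K` (`d_K` odd `< −4`, Heegner
hypothesis for `N_E` — so `p ∣ N_E` splits —, `L(E^{d_K},1) ≠ 0`: Hoffstein–Luo via x1a's
`exists_admissibleField_of_rootNumber_eq_neg_one`); a Heegner datum (`nonempty_heegnerDatum_holds`)
and its `K`-rational point `P` (`hHP`, Gross 1984 / Darmon 2004 Thm. 3.6), of infinite order by
Gross–Zagier (`hGZ`; `L'(E/K,1) = L'(E,1)·L(E^K,1) ≠ 0`, `lDerivEK_eq_deriv_mul`,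
`lDerivEK_ne_zero_iff_not_isOfFinAddOrder`); a globally minimal model `Wd` of the twist (Néron) with
its two Tamagawa values (`twistTransportPackage_holds`) and `ord_p ∏_w c_w(E/K) = 2·ord_p ∏c(E)`
(`padicValNat_tamagawaProduct_baseChange_of_heegner_odd`); the partner's rank-zero `p`-part by cases
on its Greenberg–Vatsal parity — X2a is CLOSED (`targetA_of_published`), X2b ∩ {non-split} is the
input `hMCB` (the twist stays non-split at `p`,
`not_hasSplitMultiplicativeReductionAtPrime_of_smul_eq_quadraticTwist`) through
`bsdp_of_mazurMainConjectureAt_of_analyticRank_eq_zero`; the anticyclotomic `ℤ_p`-extension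
(`ZpExtension.exists_isAnticyclotomic_holds`, Greenberg LNM 1716 §1) with a topological generator
(surjectivity of `κ`), a degree-one prime `𝔭 ∋ p` (`X11b.exists_degreeOnePrime_of_splitsIn`); then
p404431's `bsdp_of_cellC_of_not_split_of_hsieh2014_of_halvesOnTree_of_partner`. Binders: PUBLISHED
named facts (`hGV` … `hHL`, incl. Hsieh 2014 Thm. 1 `hH` and the five cited cohomological facts of
the control theorem), the three residuals c1 `hres`, c2 `h2`, c3 `h3` AT THE PAIR (NOT in print at a
reducible `p ‖ N`; c3 = Keller–Yin Thm. D shape, PREPRINT with the L1754 gap), and `hMCB`.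
CONDITIONAL on every listed binder; nothing booked; no label change.
[cite: CastellaEtAl2021, Thm. 5.3.1 and (5.5)–(5.7)] [cite: Hsieh2014, Thm. 1 (arXiv:1112.1580 pp. 3–4)]
[claim: KellerYin2024, status: under-review] [cite: Darmon2004, Thm. 3.6–3.7]
[cite: GreenbergLNM1716, §1] [cite: Gross1991, (1.1)] [cite: Miller2011LMS, Def. 1.1] -/
theorem bsdp_of_cellC_of_not_split_of_manin_of_residuals
    (hGV : lambdaMu_multiplicative_of_gvPar) (hWu : thm16_charIdeal_dvd_multiplicative_of_reducible)
    (hJs : thm61_splitMultiplicative) (hJn : thm61_nonsplitMultiplicative)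
    (hHs : exists_isSplitMultCanonical) (hHn : exists_isMultCanonical)
    (hpar : nonempty_modularParametrizationData)
    (hGS : ∀ (W : WeierstrassCurve ℚ) [W.IsElliptic] [W.IsGloballyMinimal] (p : ℕ) [Fact p.Prime],
      greenberg_stevens (W := W) (p := p))
    (hnf : exists_isNewformOf)
    (hPT : ∀ (K : Type) [Field K] [NumberField K], poitouTate_selmerStructure_duality K)
    (hPT2 : ∀ (K : Type) [Field K] [NumberField K], poitouTate_sha_tateDual K)
    (hEP : ∀ (K : Type) [Field K] [NumberField K] (v : HeightOneSpectrum (𝓞 K)),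
      localEulerPoincareCharacteristic (v.adicCompletion K))
    (hcd : fieldCdLE_two_of_numberField)
    (hBr : ∀ (K : Type) [Field K] [NumberField K] (p : ℕ) [Fact p.Prime],
      ZpExtension.decomp_not_le_kerSubgroup_of_isAnticyclotomic K p)
    (hH : hsieh2014_exists_anticyclotomicPAdicLFunction)
    (hGZ : ∀ (N : ℕ) [NeZero N] (W : WeierstrassCurve ℚ) (K : Type) [Field K] [NumberField K],
      gross_zagier N W K)
    (hKo : ∀ (N : ℕ) [NeZero N] (W : WeierstrassCurve ℚ) (K : Type) [Field K] [NumberField K],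
      kolyvagin N W K)
    (hHP : ∀ (N : ℕ) [NeZero N] (W : WeierstrassCurve ℚ) (K : Type) [Field K] [NumberField K],
      heegnerPointComplex_mem_range_map N W K)
    (hGZK : rank_eq_analyticRank_of_analyticRank_le_one)
    (hHL : HoffsteinLuo1997_exists_twist_L_one_ne_zero)
    (hc : CellC W p) (hns : ¬ W.HasSplitMultiplicativeReductionAtPrime p)
    (hMan : HasPrimeToManinDatum W p)
    (hres : HsiehFrameResidualAt W p) (h2 : NonsplitBDPValueOnTree W p)
    (h3 : NonsplitIMCEqOnTree W p)
    (hMCB : ∀ (W' : WeierstrassCurve ℚ) [W'.IsElliptic] [W'.IsGloballyMinimal],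
      CellB W' p → ¬ W'.HasSplitMultiplicativeReductionAtPrime p → MazurMainConjectureAt W' p) :
    BSDp W p := by
  have hp : p.Prime := Fact.out
  have hmod : hasEntireLFunction_rat := WeierstrassCurve.hasEntireLFunction_rat_of_exists_isNewformOf hnf
  obtain ⟨hr, hp2, hred, hmult⟩ := hc
  haveI : NeZero (W.conductorNorm ℤ) := ⟨(W.conductorNorm_pos_holds).ne'⟩
  -- `w(E) = -1`
  have hw : W.rootNumber = -1 := by
    rw [WeierstrassCurve.rootNumber_eq_neg_one_pow_analyticRank_of_exists_isNewformOf hnf W, hr]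
    norm_num
  -- the admissible auxiliary field
  obtain ⟨K, _, _, hK, hodd, hlt, hHN, hHp, hLK⟩ :=
    exists_admissibleField_of_rootNumber_eq_neg_one hnf hHL W hw p
  -- the datum with `p ∤ c`, a Heegner datum and the `K`-rational Heegner point
  obtain ⟨Dt, hcM⟩ := hMan
  obtain ⟨β, hβ⟩ := exists_dvd_sq_sub_discr_holds (W.conductorNorm ℤ) K hK hHN
  obtain ⟨H, -⟩ := nonempty_heegnerDatum_holds (W.conductorNorm ℤ) K hK hβ
  obtain ⟨ι⟩ : Nonempty (K →+* ℂ) := inferInstance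
  obtain ⟨P, hP⟩ := hHP (W.conductorNorm ℤ) W K hK hHN Dt H ι
  -- the Heegner point has infinite order: `L'(E/K,1) = L'(E,1)·L(E^K,1) ≠ 0` (Gross–Zagier)
  have hL0 : W.entireLFunction 1 = 0 := entireLFunction_one_eq_zero_of_analyticRank_eq_one hr
  obtain ⟨-, hderiv⟩ := leadingLCoeff_eq_deriv_of_analyticRank_eq_one hr
  have hLKd : LDerivEK W K ≠ 0 := by
    rw [lDerivEK_eq_deriv_mul W K hmod hL0]
    exact mul_ne_zero hderiv hLK
  have hPH : IsHeegnerPoint (W.conductorNorm ℤ) W K P := ⟨Dt, H, ι, hP⟩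
  have hPinf : ¬ IsOfFinAddOrder P :=
    (lDerivEK_ne_zero_iff_not_isOfFinAddOrder W (W.conductorNorm ℤ) K (hGZ _ W K) hK hHN hPH).mp hLKd
  -- a globally minimal model of the twist (Néron) and its transport values
  have hD0 : (NumberField.discr K : ℚ) ≠ 0 := by exact_mod_cast NumberField.discr_ne_zero K
  haveI hEt : (W.quadraticTwist (NumberField.discr K : ℚ)).IsElliptic :=
    W.isElliptic_quadraticTwist hD0
  obtain ⟨Cd, hCd⟩ := hasGlobalMinimalModel_rat_holds (W.quadraticTwist (NumberField.discr K : ℚ))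
  set Wd : WeierstrassCurve ℚ := Cd • W.quadraticTwist (NumberField.discr K : ℚ) with hWd_def
  haveI : Wd.IsGloballyMinimal := hCd
  have hWd : Cd • W.quadraticTwist (NumberField.discr K : ℚ) = Wd := rfl
  have hC : Cd⁻¹ • Wd = W.quadraticTwist (NumberField.discr K : ℚ) := by
    rw [← hWd, inv_smul_smul]
  obtain ⟨htam, hu⟩ := twistTransportPackage_holds W p K Wd Cd ⟨hr, hp2, hred, hmult⟩ hK hodd hHN hWd
  have htamK : padicValNat p (W.baseChange K).tamagawaProduct = 2 * padicValNat p W.tamagawaProduct :=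
    padicValNat_tamagawaProduct_baseChange_of_heegner_odd W p hp2 K hK hodd hHN hHp
  -- the twist: analytic rank `0`, X2, NON-split at `p`; its rank-zero `p`-part by parity cases
  have hLd : Wd.entireLFunction 1 ≠ 0 := by
    rw [← hWd, entireLFunction_smul]; exact hLK
  have hrd : Wd.analyticRank = 0 := (Wd.analyticRank_eq_zero_iff_holds (hmod _)).2 hLd
  have hXd : ClassX2 Wd p := classX2_twist W p ⟨hp2, hred, hmult⟩ K hK hHp Wd ⟨Cd⁻¹, hC⟩
  have hnsd : ¬ Wd.HasSplitMultiplicativeReductionAtPrime p :=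
    not_hasSplitMultiplicativeReductionAtPrime_of_smul_eq_quadraticTwist W Wd hK p hp2 hmult hns hHp hC
  have hbsdd : BSDp Wd p := by
    by_cases hgv : GVPar Wd p
    · exact targetA_of_published hGV hWu hJs hJn hHs hHn hGZK hmod hpar hGS Wd p ⟨hrd, hXd, hgv⟩
    · exact bsdp_of_mazurMainConjectureAt_of_analyticRank_eq_zero hJs hJn hHs hHn hGZK hmod hpar Wd p
        (hGS Wd p) hXd.1 hXd.2.2 hrd (hMCB Wd ⟨hrd, hXd, hgv⟩ hnsd)
  have htw : PPartRankZero Wd p :=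
    pPartRankZero_of_pPart hGZK Wd p hrd (pPart_of_bsdp hmod hGZK Wd p (by omega) hbsdd)
  -- the anticyclotomic `ℤ_p`-extension, a topological generator, a degree-one prime above `p`
  haveI : IsTotallyComplex K := hK.2
  obtain ⟨κ, hκ⟩ := ZpExtension.exists_isAnticyclotomic_holds (K := K) (p := p) hK.1
    (fun w ↦ IsTotallyComplex.isComplex w)
  obtain ⟨γ, hγ⟩ := κ.surjective (Multiplicative.ofAdd 1)
  haveI : Fact (κ.IsTopGenerator γ) := ⟨hγ⟩
  obtain ⟨𝔭, h𝔭, he, hf⟩ := X11b.exists_degreeOnePrime_of_splitsIn K p hK.1 (hHp p hp dvd_rfl)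
  -- conclude by the (b1) road
  exact bsdp_of_cellC_of_not_split_of_hsieh2014_of_halvesOnTree_of_partner W p hnf hPT hPT2 hEP hcd
    hBr hH (W.conductorNorm ℤ) K Dt H ι P (hGZ _ W K) (hKo _ W K) hGZK ⟨hr, hp2, hred, hmult⟩ hns rfl
    hK hlt hHN hHp hP hPinf hcM hLK Wd Cd hWd htw htam hu htamK κ hκ γ 𝔭 h𝔭 he hf hres h2 h3

end Pointwise

/-! ### Class level: the Manin condition moved to the optimal curve -/

section ClassLevel

/-- **X2c ∩ {non-split} ⇒ `BSD(E,p)`, CLASS LEVEL — the planner's `stub_nonsplit` of line L4-b1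
from c1 ∧ c2 ∧ c3 + Mazur's MC on X2b ∩ {non-split} + PUBLISHED facts, NO per-pair binder.** For
every rank-one X2 pair `(E,p)` at a NON-split `p`: `BSD(E,p)`, given the PUBLISHED named facts
(incl. Edixhoven's integrality `hEd`, Mazur 1978 Cor. 4.1 `hMaz`, Cassels `hCassels`), the three
declared residuals at every non-split CellC pair (`hres` c1 `HsiehFrameResidualAt`, `h2` c2
`NonsplitBDPValueOnTree`, `h3` c3 `NonsplitIMCEqOnTree` — NOT in print), and Mazur's main
conjecture at every X2b ∩ {non-split} pair (`hMCB` — crux 3's non-split half; used only at the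
CGLS partner of a ψ-odd pair). Proof: the `X₀(N)`-optimal curve `W₀ ∼ W` carries a Manin datum
prime to `p` (`exists_isIsogenous_hasPrimeToManinDatum`); CellC and non-splitness pass to `W₀`
(`CellC.of_isIsogenous`, `IsogenyQuotientLine.hasSplitMultiplicativeReductionAtPrime_of_isIsogenous`);
`bsdp_of_cellC_of_not_split_of_manin_of_residuals` at `W₀`; Cassels (`bsdp_of_isIsogenous_of_bsdp`).
CONDITIONAL on every listed binder; nothing booked; X2 CONSTRUCTION-SHAPED; no label change.
[cite: CastellaEtAl2021, Thm. 5.3.1] [cite: Mazur1978, Cor. 4.1] [cite: MilneADT2006, Thm. I.7.3]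
[cite: Hsieh2014, Thm. 1 (arXiv:1112.1580 pp. 3–4)] [claim: KellerYin2024, status: under-review]
[cite: Miller2011LMS, Def. 1.1] -/
theorem bsdp_of_cellC_of_not_split_of_residuals
    (hGV : lambdaMu_multiplicative_of_gvPar) (hWu : thm16_charIdeal_dvd_multiplicative_of_reducible)
    (hJs : thm61_splitMultiplicative) (hJn : thm61_nonsplitMultiplicative)
    (hHs : exists_isSplitMultCanonical) (hHn : exists_isMultCanonical)
    (hpar : nonempty_modularParametrizationData)
    (hGS : ∀ (W : WeierstrassCurve ℚ) [W.IsElliptic] [W.IsGloballyMinimal] (p : ℕ) [Fact p.Prime],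
      greenberg_stevens (W := W) (p := p))
    (hnf : exists_isNewformOf)
    (hPT : ∀ (K : Type) [Field K] [NumberField K], poitouTate_selmerStructure_duality K)
    (hPT2 : ∀ (K : Type) [Field K] [NumberField K], poitouTate_sha_tateDual K)
    (hEP : ∀ (K : Type) [Field K] [NumberField K] (v : HeightOneSpectrum (𝓞 K)),
      localEulerPoincareCharacteristic (v.adicCompletion K))
    (hcd : fieldCdLE_two_of_numberField)
    (hBr : ∀ (K : Type) [Field K] [NumberField K] (p : ℕ) [Fact p.Prime],
      ZpExtension.decomp_not_le_kerSubgroup_of_isAnticyclotomic K p)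
    (hH : hsieh2014_exists_anticyclotomicPAdicLFunction)
    (hGZ : ∀ (N : ℕ) [NeZero N] (W : WeierstrassCurve ℚ) (K : Type) [Field K] [NumberField K],
      gross_zagier N W K)
    (hKo : ∀ (N : ℕ) [NeZero N] (W : WeierstrassCurve ℚ) (K : Type) [Field K] [NumberField K],
      kolyvagin N W K)
    (hHP : ∀ (N : ℕ) [NeZero N] (W : WeierstrassCurve ℚ) (K : Type) [Field K] [NumberField K],
      heegnerPointComplex_mem_range_map N W K)
    (hGZK : rank_eq_analyticRank_of_analyticRank_le_one)
    (hHL : HoffsteinLuo1997_exists_twist_L_one_ne_zero)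
    (hEd : edixhoven_optimalManinConstant_integral) (hMaz : mazur_not_dvd_maninConstant_of_odd)
    (hCassels : bsdRHS_eq_of_isIsogenous)
    (hres : ∀ (W : WeierstrassCurve ℚ) [W.IsElliptic] [W.IsGloballyMinimal] (p : ℕ) [Fact p.Prime],
      CellC W p → ¬ W.HasSplitMultiplicativeReductionAtPrime p → HsiehFrameResidualAt W p)
    (h2 : ∀ (W : WeierstrassCurve ℚ) [W.IsElliptic] [W.IsGloballyMinimal] (p : ℕ) [Fact p.Prime],
      CellC W p → ¬ W.HasSplitMultiplicativeReductionAtPrime p → NonsplitBDPValueOnTree W p)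
    (h3 : ∀ (W : WeierstrassCurve ℚ) [W.IsElliptic] [W.IsGloballyMinimal] (p : ℕ) [Fact p.Prime],
      CellC W p → ¬ W.HasSplitMultiplicativeReductionAtPrime p → NonsplitIMCEqOnTree W p)
    (hMCB : ∀ (W : WeierstrassCurve ℚ) [W.IsElliptic] [W.IsGloballyMinimal] (p : ℕ) [Fact p.Prime],
      CellB W p → ¬ W.HasSplitMultiplicativeReductionAtPrime p → MazurMainConjectureAt W p)
    (W : WeierstrassCurve ℚ) [W.IsElliptic] [W.IsGloballyMinimal] (p : ℕ) [Fact p.Prime]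
    (hc : CellC W p) (hns : ¬ W.HasSplitMultiplicativeReductionAtPrime p) : BSDp W p := by
  refine bsdp_of_cellC_of_forall_isIsogenous hEd hMaz hCassels hpar hnf hGZK W p hc ?_
  intro W₀ _ _ hiso hc₀ hMan₀
  have hns₀ : ¬ W₀.HasSplitMultiplicativeReductionAtPrime p := fun h ↦
    hns (IsogenyQuotientLine.hasSplitMultiplicativeReductionAtPrime_of_isIsogenous
      hiso.symm_of_charZero h)
  exact bsdp_of_cellC_of_not_split_of_manin_of_residuals W₀ p hGV hWu hJs hJn hHs hHn hpar hGS hnf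
    hPT hPT2 hEP hcd hBr hH hGZ hKo hHP hGZK hHL hc₀ hns₀ hMan₀ (hres W₀ p hc₀ hns₀) (h2 W₀ p hc₀ hns₀)
    (h3 W₀ p hc₀ hns₀) (fun W' _ _ hB hns' ↦ hMCB W' p hB hns')

end ClassLevel

end Summit.BirchSwinnertonDyer.Rank1Residual.X2

end
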